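/-
Copyright (c) 2026 the pub-hodgecm-mathlib formalisation cell (harness21).  Prover seat hodgecm-mathlib-F0P2-p06 (g10), 2026-09-01.  Road «S3-tree» (acting architect F0P3-p01 (g16),
chair F0P3a-plan (g11)), brick T3′ «depth-zero κ-transfer», population (P-2) TYPE (2), row (R0²) «LEVEL-ONE ROW»: organ FILE α «THE MÖBIUS SHIFT OF A MATRIX» — the generic
algebra of the Cayley∕Möbius shift `φ(M) = (aM + b)(bM + a)⁻¹` (`a = c + 1`, `b = c − 1`: ★ CAYLEY's `(1 + Z)(1 − Z)⁻¹`, `Z = c⁻¹(M − 1)(M + 1)⁻¹`) WITHOUT EIGENVALUES.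
-/
import Mathlib.LinearAlgebra.Matrix.Charpoly.Coeff
import Mathlib.LinearAlgebra.Matrix.NonsingularInverse
import Mathlib.LinearAlgebra.Matrix.Reindex
import Mathlib.RingTheory.Adjoin.Basic
import Mathlib.Algebra.Ring.Subring.Basic
import HarnessLib

/-!
# The Möbius shift `φ(M) = (a·M + b)·(b·M + a)⁻¹` of a square matrix: unitarity, equivariance, eigenvectors, blocks, the shifted order, and the 2×2 invariants

Topic `NumberTheory/Automorphic`; namespace `Literature.NumberTheory.Automorphic.MoebiusShift`.  THEOREMS ONLY (no definition, no instance, no notation, no named fact, no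
`sorry`); Mathlib-only, any commutative ring ∕ field, any index type.  Cell `pub/hodgecm-mathlib` (D-0151), crux H413 = `stmt-HodgeConjecture-24833`; road «S3-tree», brick T3′
«depth-zero κ-transfer» (HEAD v4 `depthZeroKappaTransfer_hyperspecial_typeTwo`, P-2 assembly holder F0P2-p06 (g10), A-85 (3)), row (R0²) of the ★ type-(2) socket
`finsum_finExplicitDelta_mul_classOrbitalIntegral_eq_of_irreducible_of_strata` (p846003): `n₀(δ₊) − n₀(δ₋) = (−q)^{n−2}·W₂(N−1)`.  Census `F0/P2/F0P2-p06/g10/CENSUS-T3prime-P2-assembly.F0P2p06g10.md`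
§3.  HONEST LABEL: HC_CM is proved only modulo the cell's 2 remaining named inputs (hLiu418, h413) until rung 0 closes; this file is elementary matrix algebra and asserts nothing printed.

THE MATHEMATICS.  The residually-trivial fixed hyperspecial vertices of a deep torus element `δ` are the fixed vertices of the UNIT `Y` of the shifted order `𝒪[(δ−1)∕ϖ]` (★
`ResiduallyTrivialFixedCosetCountCayley`, Kottwitz 1986 §3), and `Y` is the Cayley∕Möbius shift `Y = φ(δ)`, `φ(t) = ((c+1)t + (c−1))∕((c−1)t + (c+1))` (`c = ϖ`; ★ CAYLEY
`SplitTorusOrderCayleyShift` writes it `(1 + Z)(1 − Z)⁻¹`, `Z = c⁻¹(t−1)(t+1)⁻¹`).  For the SPLIT torus (type (1)) the tree reads `φ` on eigenvalues; for the type-(2) torus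
(`χ_g` irreducible over `L_w`) there is no eigenvalue in `L_w`, so this file develops `φ` ON THE MATRIX: with `D := b·M + a·1`, `N := a·M + b·1` and `φ(M) := N·D⁻¹`
(§1) `φ` preserves every `σ`-sesquilinear form whose coefficients `a, b` are `σ`-fixed (`ᵗ(σN)HN − ᵗ(σD)HD = (a² − b²)(ᵗ(σM)HM − H)`), commutes with conjugation, with
`reindex` and with block-diagonal sums, and maps a `μ`-eigenvector to a `φ(μ)`-eigenvector; (§2) CAYLEY–HAMILTON puts `B⁻¹` in the order `𝒪[W]` whenever `B ∈ 𝒪[W]` has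
characteristic polynomial over `𝒪` and unit determinant; (§3) entrywise-integral matrices are closed under the ring operations and under inversion with unit determinant,
and have characteristic polynomial over `𝒪`; (§4) hence for `M = 1 + c·W` with `W` entrywise integral, `φ(M) = N₊N₋⁻¹` with `N± = 2 + (c±1)W`, and `φ(M), φ(M)⁻¹ ∈ 𝒪[W]`,
`W ∈ 𝒪[φ(M)]` as soon as `det N₊, det N₋, 2, c − 1` are units of `𝒪` (the order identity `𝒪[W] = 𝒪[φ(M)]` that ★ ORDER-STABILITY consumes); (§5) for `2 × 2` matrices the
invariants of `φ(g)` without eigenvalues: `det φ(g) = det N∕det D`, `tr φ(g)·det D = tr N·tr D − tr(ND)`, `disc χ_{φ(g)}·(det D)² = (a²−b²)²·disc χ_g`,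
`χ_{φ(g)}(φ(u))·(bu+a)²·det D = (a²−b²)²·χ_g(u)` — the exponent dictionary `(n, N) ↦ (n−2, N−1)` of the type-(2) Cayley shift is read off these.

## References
* [Weyl1939] H. Weyl, *The Classical Groups* (1939), Chap. II §10 (Cayley's rational parametrisation).
* [Kottwitz1986] R. E. Kottwitz, *Base change for unit elements of Hecke algebras*, Compositio Math. 60 (1986), §3.
* [Rogawski1990] J. D. Rogawski, *Automorphic Representations of Unitary Groups in Three Variables* (1990), §4.9 Prop. 4.9.1 (b) p. 55.
* [HornJohnson2013] R. A. Horn, C. R. Johnson, *Matrix Analysis*, 2nd ed. (2013), §2.1 (Cayley–Hamilton), §0.8.2 (adjugate).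
-/

set_option autoImplicit false

open Matrix Polynomial

namespace Literature.NumberTheory.Automorphic.MoebiusShift

/-! ## §1 The Möbius shift over a commutative ring: forms, conjugation, blocks, eigenvectors -/

section Ring

variable {R : Type*} [CommRing R] {n : Type*} [Fintype n] [DecidableEq n]

omit [Fintype n] in
/-- The `σ`-adjoint of a linear combination `a·M + b·1` with `σ`-fixed coefficients. [cite: Weyl1939, Chap. II §10] -/
theorem transpose_map_smul_add_smul_one (σ : R →+* R) (M : Matrix n n R) {a b : R} (ha : σ a = a) (hb : σ b = b) :
    ((a • M + b • (1 : Matrix n n R)).map σ)ᵀ = a • (M.map σ)ᵀ + b • 1 := by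
  ext i j
  rcases eq_or_ne i j with h | h
  · subst h; simp [Matrix.map_apply, ha, hb]
  · simp [Matrix.map_apply, ha, h, h.symm]

/-- **The two sides of the shift have the same Gram matrix on a form preserved by `M`**: if `ᵗ(σM)·H·M = H` and `σ` fixes `a, b`, then
`ᵗ(σ(aM+b))·H·(aM+b) = ᵗ(σ(bM+a))·H·(bM+a)` (both equal `(a²+b²)H + ab(ᵗ(σM)H + HM)`). [cite: Weyl1939, Chap. II §10] -/
theorem gram_smul_add_eq_gram_smul_add (σ : R →+* R) (H M : Matrix n n R) (hM : (M.map σ)ᵀ * H * M = H) {a b : R} (ha : σ a = a) (hb : σ b = b) :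
    ((a • M + b • (1 : Matrix n n R)).map σ)ᵀ * H * (a • M + b • 1) = ((b • M + a • (1 : Matrix n n R)).map σ)ᵀ * H * (b • M + a • 1) := by
  rw [transpose_map_smul_add_smul_one σ M ha hb, transpose_map_smul_add_smul_one σ M hb ha]
  simp only [add_mul, mul_add, smul_mul_assoc, mul_smul_comm, Matrix.one_mul, Matrix.mul_one, smul_smul, smul_add, hM]
  abel_nf
  simp only [mul_comm b a]
  abel

/-- **The Möbius shift preserves the form**: if `ᵗ(σM)·H·M = H`, `σ a = a`, `σ b = b` and `det(bM + a)` is a unit, then `Y := (aM+b)(bM+a)⁻¹` satisfies `ᵗ(σY)·H·Y = H`.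
[cite: Weyl1939, Chap. II §10] -/
theorem transpose_map_moebius_mul_mul (σ : R →+* R) (H M : Matrix n n R) (hM : (M.map σ)ᵀ * H * M = H) {a b : R} (ha : σ a = a) (hb : σ b = b)
    (hD : IsUnit (b • M + a • (1 : Matrix n n R)).det) :
    (((a • M + b • (1 : Matrix n n R)) * (b • M + a • (1 : Matrix n n R))⁻¹).map σ)ᵀ * H * ((a • M + b • 1) * (b • M + a • 1)⁻¹) = H := by
  set D : Matrix n n R := b • M + a • 1 with hDdef
  set N : Matrix n n R := a • M + b • 1 with hNdef
  have hkey : (N.map σ)ᵀ * H * N = (D.map σ)ᵀ * H * D := gram_smul_add_eq_gram_smul_add σ H M hM ha hb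
  have h1 : D * D⁻¹ = 1 := Matrix.mul_nonsing_inv D hD
  have h2 : (D⁻¹.map σ)ᵀ * (D.map σ)ᵀ = 1 := by
    rw [← Matrix.transpose_mul, ← Matrix.map_mul, h1, Matrix.map_one σ (map_zero σ) (map_one σ), Matrix.transpose_one]
  calc ((N * D⁻¹).map σ)ᵀ * H * (N * D⁻¹)
      = (D⁻¹.map σ)ᵀ * ((N.map σ)ᵀ * H * N) * D⁻¹ := by
        rw [Matrix.map_mul, Matrix.transpose_mul]; simp only [Matrix.mul_assoc]
    _ = (D⁻¹.map σ)ᵀ * (D.map σ)ᵀ * (H * (D * D⁻¹)) := by rw [hkey]; simp only [Matrix.mul_assoc]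
    _ = H := by rw [h2, h1, Matrix.mul_one, Matrix.one_mul]

/-- **Conjugation equivariance**: `φ(PMP⁻¹) = P·φ(M)·P⁻¹` for `P` with unit determinant. [cite: HornJohnson2013, §0.8.2] -/
theorem moebius_conj (P M : Matrix n n R) (hP : IsUnit P.det) (a b : R) (hD : IsUnit (b • M + a • (1 : Matrix n n R)).det) :
    (a • (P * M * P⁻¹) + b • (1 : Matrix n n R)) * (b • (P * M * P⁻¹) + a • (1 : Matrix n n R))⁻¹ =
      P * ((a • M + b • 1) * (b • M + a • 1)⁻¹) * P⁻¹ := by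
  have hlin : ∀ x y : R, x • (P * M * P⁻¹) + y • (1 : Matrix n n R) = P * (x • M + y • 1) * P⁻¹ := fun x y => by
    rw [mul_add, add_mul, mul_smul_comm, smul_mul_assoc, mul_smul_comm, smul_mul_assoc, Matrix.mul_one, Matrix.mul_nonsing_inv P hP]
  have hinv : (P * (b • M + a • 1) * P⁻¹)⁻¹ = P * (b • M + a • 1)⁻¹ * P⁻¹ := by
    refine Matrix.inv_eq_right_inv ?_
    calc P * (b • M + a • 1) * P⁻¹ * (P * (b • M + a • 1)⁻¹ * P⁻¹)
        = P * ((b • M + a • 1) * ((P⁻¹ * P) * (b • M + a • 1)⁻¹)) * P⁻¹ := by simp only [Matrix.mul_assoc]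
      _ = 1 := by rw [Matrix.nonsing_inv_mul P hP, Matrix.one_mul, Matrix.mul_nonsing_inv _ hD, Matrix.mul_one, Matrix.mul_nonsing_inv P hP]
  rw [hlin, hlin, hinv]
  calc P * (a • M + b • 1) * P⁻¹ * (P * (b • M + a • 1)⁻¹ * P⁻¹)
      = P * ((a • M + b • 1) * ((P⁻¹ * P) * (b • M + a • 1)⁻¹)) * P⁻¹ := by simp only [Matrix.mul_assoc]
    _ = P * ((a • M + b • 1) * (b • M + a • 1)⁻¹) * P⁻¹ := by rw [Matrix.nonsing_inv_mul P hP, Matrix.one_mul]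

/-- **`reindex` equivariance**: `φ(reindex e e M) = reindex e e (φ M)`. [cite: HornJohnson2013, §0.8.2] -/
theorem moebius_reindex {m : Type*} [Fintype m] [DecidableEq m] (e : n ≃ m) (M : Matrix n n R) (a b : R) :
    (a • reindex e e M + b • (1 : Matrix m m R)) * (b • reindex e e M + a • (1 : Matrix m m R))⁻¹ =
      reindex e e ((a • M + b • 1) * (b • M + a • 1)⁻¹) := by
  have h1 : ∀ x y : R, x • reindex e e M + y • (1 : Matrix m m R) = reindex e e (x • M + y • 1) := fun x y => by
    ext i j
    simp [Matrix.reindex_apply, Matrix.one_apply]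
  have h2 : ∀ A B : Matrix n n R, reindex e e A * reindex e e B = reindex e e (A * B) := fun A B => by
    simp only [Matrix.reindex_apply]
    exact Matrix.submatrix_mul_equiv A B e.symm e.symm e.symm
  rw [h1, h1, Matrix.inv_reindex, h2]

/-- **Block-diagonal compatibility**: `φ(A ⊕ B) = φ(A) ⊕ φ(B)` when both denominators are invertible. [cite: HornJohnson2013, §0.8.2] -/
theorem moebius_fromBlocks {m : Type*} [Fintype m] [DecidableEq m] (A : Matrix n n R) (B : Matrix m m R) (a b : R)
    (hA : IsUnit (b • A + a • (1 : Matrix n n R)).det) (hB : IsUnit (b • B + a • (1 : Matrix m m R)).det) :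
    (a • fromBlocks A 0 0 B + b • (1 : Matrix (n ⊕ m) (n ⊕ m) R)) * (b • fromBlocks A 0 0 B + a • (1 : Matrix (n ⊕ m) (n ⊕ m) R))⁻¹ =
      fromBlocks ((a • A + b • 1) * (b • A + a • 1)⁻¹) 0 0 ((a • B + b • 1) * (b • B + a • 1)⁻¹) := by
  have h1 : ∀ x y : R, x • fromBlocks A 0 0 B + y • (1 : Matrix (n ⊕ m) (n ⊕ m) R) = fromBlocks (x • A + y • 1) 0 0 (x • B + y • 1) := fun x y => by
    rw [← Matrix.fromBlocks_one, Matrix.fromBlocks_smul, Matrix.fromBlocks_smul, Matrix.fromBlocks_add]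
    simp only [smul_zero, add_zero]
  have hinv : (fromBlocks (b • A + a • 1) 0 0 (b • B + a • 1))⁻¹ = fromBlocks (b • A + a • 1)⁻¹ 0 0 (b • B + a • 1)⁻¹ := by
    refine Matrix.inv_eq_right_inv ?_
    rw [Matrix.fromBlocks_multiply]
    simp [Matrix.mul_nonsing_inv _ hA, Matrix.mul_nonsing_inv _ hB, Matrix.fromBlocks_one]
  rw [h1, h1, hinv, Matrix.fromBlocks_multiply]
  simp

/-- **The denominator acts on an eigenvector by the scalar `bμ + a`.** [cite: HornJohnson2013, §2.1] -/
theorem smul_add_smul_one_mulVec_of_eigenvector {M : Matrix n n R} {p : n → R} {μ : R} (hp : M *ᵥ p = μ • p) (x y : R) :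
    (x • M + y • (1 : Matrix n n R)) *ᵥ p = (x * μ + y) • p := by
  rw [Matrix.add_mulVec, Matrix.smul_mulVec, Matrix.smul_mulVec, hp, Matrix.one_mulVec, smul_smul, ← add_smul]

/-- **The Möbius shift maps a `μ`-eigenvector to a `φ(μ)`-eigenvector** (over a field: `φ(M)·p = ((aμ+b)∕(bμ+a))·p` when `bμ + a ≠ 0`). [cite: HornJohnson2013, §2.1] -/
theorem moebius_mulVec_of_eigenvector {K : Type*} [Field K] {M : Matrix n n K} {p : n → K} {μ : K} (hp : M *ᵥ p = μ • p) {a b : K} (hμ : b * μ + a ≠ 0)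
    (hD : IsUnit (b • M + a • (1 : Matrix n n K)).det) :
    ((a • M + b • (1 : Matrix n n K)) * (b • M + a • (1 : Matrix n n K))⁻¹) *ᵥ p = ((a * μ + b) / (b * μ + a)) • p := by
  have h2 : (b * μ + a) • ((b • M + a • (1 : Matrix n n K))⁻¹ *ᵥ p) = p := by
    have h3 : (b • M + a • (1 : Matrix n n K))⁻¹ *ᵥ ((b • M + a • (1 : Matrix n n K)) *ᵥ p) = p := by
      rw [Matrix.mulVec_mulVec, Matrix.nonsing_inv_mul _ hD, Matrix.one_mulVec]
    rwa [smul_add_smul_one_mulVec_of_eigenvector hp, Matrix.mulVec_smul] at h3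
  have h1 : (b • M + a • (1 : Matrix n n K))⁻¹ *ᵥ p = (b * μ + a)⁻¹ • p := by
    calc (b • M + a • (1 : Matrix n n K))⁻¹ *ᵥ p = (b * μ + a)⁻¹ • ((b * μ + a) • ((b • M + a • (1 : Matrix n n K))⁻¹ *ᵥ p)) := by
          rw [smul_smul, inv_mul_cancel₀ hμ, one_smul]
      _ = (b * μ + a)⁻¹ • p := by rw [h2]
  rw [← Matrix.mulVec_mulVec, h1, Matrix.mulVec_smul, smul_add_smul_one_mulVec_of_eigenvector hp, smul_smul, div_eq_mul_inv, mul_comm]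

end Ring


/-! ## §2 Cayley–Hamilton: `B⁻¹ ∈ 𝒪[W]` when `B ∈ 𝒪[W]` has characteristic polynomial over `𝒪` and unit determinant -/

section Adjoin

variable {K : Type*} [Field K] {n : Type*} [Fintype n] [DecidableEq n] (O : Subring K)

/-- An element of `K` lying in `O` acts on `𝒪[W]`: `r • B ∈ 𝒪[W]` for `B ∈ 𝒪[W]`, `r ∈ O`. [cite: HornJohnson2013, §2.1] -/
theorem smul_mem_adjoin_of_mem {W B : Matrix n n K} (hB : B ∈ Algebra.adjoin O ({W} : Set (Matrix n n K))) {r : K} (hr : r ∈ O) :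
    r • B ∈ Algebra.adjoin O ({W} : Set (Matrix n n K)) := by
  have h : (⟨r, hr⟩ : O) • B ∈ Algebra.adjoin O ({W} : Set (Matrix n n K)) := Subalgebra.smul_mem _ hB _
  rwa [Subring.smul_def] at h

/-- A polynomial with coefficients in `O`, evaluated at `B ∈ 𝒪[W]`, lies in `𝒪[W]`. [cite: HornJohnson2013, §2.1] -/
theorem aeval_mem_adjoin_of_coeff_mem {W B : Matrix n n K} (hB : B ∈ Algebra.adjoin O ({W} : Set (Matrix n n K))) (q : K[X])
    (hq : ∀ i, q.coeff i ∈ O) : aeval B q ∈ Algebra.adjoin O ({W} : Set (Matrix n n K)) := by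
  rw [aeval_eq_sum_range]
  refine Subalgebra.sum_mem _ fun i _ => ?_
  exact smul_mem_adjoin_of_mem O (Subalgebra.pow_mem _ hB i) (hq i)

/-- **CAYLEY–HAMILTON INVERSION INSIDE AN ORDER**: if `B ∈ 𝒪[W]` has characteristic polynomial with coefficients in `O` and `det B` is a unit of `O` (`d·det B = 1`, `d ∈ O`), then
`B⁻¹ ∈ 𝒪[W]` — indeed `B⁻¹ = −c₀⁻¹·q(B)` with `χ_B = X·q + c₀`, `c₀ = ±det B`. [cite: HornJohnson2013, §2.1 (Cayley–Hamilton), §0.8.2] -/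
theorem inv_mem_adjoin_of_charpoly_coeff_mem {W B : Matrix n n K} (hB : B ∈ Algebra.adjoin O ({W} : Set (Matrix n n K)))
    (hc : ∀ i, B.charpoly.coeff i ∈ O) (hd : ∃ d ∈ O, d * B.det = 1) : B⁻¹ ∈ Algebra.adjoin O ({W} : Set (Matrix n n K)) := by
  obtain ⟨d, hdO, hd⟩ := hd
  -- Cayley–Hamilton: `q(B)·B + c₀ = 0` with `q = divX χ_B`, `c₀ = χ_B(0) = (−1)^n det B`
  set q : K[X] := B.charpoly.divX with hqdef
  have hCH : aeval B q * B + B.charpoly.coeff 0 • (1 : Matrix n n K) = 0 := by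
    have h := Matrix.aeval_self_charpoly B
    rw [← divX_mul_X_add B.charpoly, aeval_add, aeval_mul, aeval_X, aeval_C, Algebra.algebraMap_eq_smul_one] at h
    exact h
  have hc0 : B.charpoly.coeff 0 = (-1) ^ Fintype.card n * B.det := by
    rw [Matrix.det_eq_sign_charpoly_coeff, ← mul_assoc, ← pow_add, ← two_mul, pow_mul, neg_one_sq, one_pow, one_mul]
  -- the explicit left inverse `−((−1)^n d) • q(B)`
  have hinv : B⁻¹ = (-((-1) ^ Fintype.card n * d)) • aeval B q := by
    refine Matrix.inv_eq_left_inv ?_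
    have h1 : aeval B q * B = -(B.charpoly.coeff 0 • (1 : Matrix n n K)) := eq_neg_of_add_eq_zero_left hCH
    rw [smul_mul_assoc, h1, hc0, smul_neg, smul_smul]
    have h2 : -((-1 : K) ^ Fintype.card n * d) * ((-1) ^ Fintype.card n * B.det) = -1 := by
      calc -((-1 : K) ^ Fintype.card n * d) * ((-1) ^ Fintype.card n * B.det) = -(((-1 : K) ^ Fintype.card n) ^ 2 * (d * B.det)) := by ring
        _ = -1 := by rw [← pow_mul, mul_comm (Fintype.card n) 2, pow_mul, neg_one_sq, one_pow, one_mul, hd]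
    rw [h2, neg_smul, one_smul, neg_neg]
  rw [hinv]
  refine smul_mem_adjoin_of_mem O (aeval_mem_adjoin_of_coeff_mem O hB q fun i => ?_) ?_
  · rw [hqdef, coeff_divX]; exact hc _
  · exact O.neg_mem (O.mul_mem (O.pow_mem (O.neg_mem O.one_mem) _) hdO)

end Adjoin

/-! ## §3 Entrywise-integral matrices: ring closure, characteristic polynomial and determinant over `O`, inversion with unit determinant -/

section Entrywise

variable {K : Type*} [Field K] {n : Type*} [Fintype n] [DecidableEq n] (O : Subring K)

omit [Fintype n] [DecidableEq n] in
/-- An entrywise-integral matrix is the image of a matrix over `O`. [cite: HornJohnson2013, §0.8.2] -/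
theorem exists_map_subtype_eq_of_forall_mem {m : Type*} {A : Matrix m n K} (hA : ∀ i j, A i j ∈ O) :
    ∃ A₀ : Matrix m n O, A₀.map O.subtype = A :=
  ⟨Matrix.of fun i j => ⟨A i j, hA i j⟩, by ext i j; rfl⟩

/-- **The characteristic polynomial of an entrywise-integral matrix has coefficients in `O`.** [cite: HornJohnson2013, §2.1] -/
theorem charpoly_coeff_mem_of_forall_mem {A : Matrix n n K} (hA : ∀ i j, A i j ∈ O) (k : ℕ) : A.charpoly.coeff k ∈ O := by
  obtain ⟨A₀, rfl⟩ := exists_map_subtype_eq_of_forall_mem O hA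
  rw [Matrix.charpoly_map, Polynomial.coeff_map]
  exact (A₀.charpoly.coeff k).2

/-- The determinant of an entrywise-integral matrix lies in `O`. [cite: HornJohnson2013, §0.8.2] -/
theorem det_mem_of_forall_mem {A : Matrix n n K} (hA : ∀ i j, A i j ∈ O) : A.det ∈ O := by
  obtain ⟨A₀, rfl⟩ := exists_map_subtype_eq_of_forall_mem O hA
  rw [← RingHom.mapMatrix_apply, ← RingHom.map_det]
  exact (A₀.det).2

omit [DecidableEq n] in
/-- The trace of an entrywise-integral matrix lies in `O`. [cite: HornJohnson2013, §0.8.2] -/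
theorem trace_mem_of_forall_mem {A : Matrix n n K} (hA : ∀ i j, A i j ∈ O) : A.trace ∈ O :=
  O.sum_mem fun i _ => hA i i

omit [Fintype n] [DecidableEq n] in
/-- Sums of entrywise-integral matrices are entrywise integral. [cite: HornJohnson2013, §0.8.2] -/
theorem forall_mem_add {A B : Matrix n n K} (hA : ∀ i j, A i j ∈ O) (hB : ∀ i j, B i j ∈ O) : ∀ i j, (A + B) i j ∈ O :=
  fun i j => O.add_mem (hA i j) (hB i j)

omit [Fintype n] [DecidableEq n] in
/-- Differences of entrywise-integral matrices are entrywise integral. [cite: HornJohnson2013, §0.8.2] -/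
theorem forall_mem_sub {A B : Matrix n n K} (hA : ∀ i j, A i j ∈ O) (hB : ∀ i j, B i j ∈ O) : ∀ i j, (A - B) i j ∈ O :=
  fun i j => O.sub_mem (hA i j) (hB i j)

omit [DecidableEq n] in
/-- Products of entrywise-integral matrices are entrywise integral. [cite: HornJohnson2013, §0.8.2] -/
theorem forall_mem_mul {A B : Matrix n n K} (hA : ∀ i j, A i j ∈ O) (hB : ∀ i j, B i j ∈ O) : ∀ i j, (A * B) i j ∈ O :=
  fun i j => by rw [Matrix.mul_apply]; exact O.sum_mem fun k _ => O.mul_mem (hA i k) (hB k j)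

omit [Fintype n] [DecidableEq n] in
/-- Integral scalar multiples of entrywise-integral matrices are entrywise integral. [cite: HornJohnson2013, §0.8.2] -/
theorem forall_mem_smul {A : Matrix n n K} (hA : ∀ i j, A i j ∈ O) {r : K} (hr : r ∈ O) : ∀ i j, (r • A) i j ∈ O :=
  fun i j => by rw [Matrix.smul_apply, smul_eq_mul]; exact O.mul_mem hr (hA i j)

omit [Fintype n] in
/-- Integral scalar matrices are entrywise integral. [cite: HornJohnson2013, §0.8.2] -/
theorem forall_mem_smul_one {r : K} (hr : r ∈ O) : ∀ i j, (r • (1 : Matrix n n K)) i j ∈ O :=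
  fun i j => by
    rw [Matrix.smul_apply, Matrix.one_apply, smul_eq_mul, mul_ite, mul_one, mul_zero]
    split_ifs
    · exact hr
    · exact O.zero_mem

/-- The adjugate of an entrywise-integral matrix is entrywise integral. [cite: HornJohnson2013, §0.8.2] -/
theorem forall_mem_adjugate {A : Matrix n n K} (hA : ∀ i j, A i j ∈ O) : ∀ i j, A.adjugate i j ∈ O := by
  obtain ⟨A₀, rfl⟩ := exists_map_subtype_eq_of_forall_mem O hA
  intro i j
  rw [← RingHom.mapMatrix_apply, ← RingHom.map_adjugate, RingHom.mapMatrix_apply, Matrix.map_apply]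
  exact (A₀.adjugate i j).2

/-- **Inversion with unit determinant**: if `A` is entrywise integral and `d·det A = 1` with `d ∈ O`, then `A⁻¹ = d·adj A` is entrywise integral. [cite: HornJohnson2013, §0.8.2] -/
theorem forall_mem_inv {A : Matrix n n K} (hA : ∀ i j, A i j ∈ O) (hd : ∃ d ∈ O, d * A.det = 1) : ∀ i j, A⁻¹ i j ∈ O := by
  obtain ⟨d, hdO, hd⟩ := hd
  have hdet : A.det ≠ 0 := fun h => by rw [h, mul_zero] at hd; exact zero_ne_one hd
  have hdinv : A.det⁻¹ = d := by
    rw [← mul_inv_cancel₀ hdet, mul_comm] at hd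
    exact (mul_left_cancel₀ hdet hd).symm
  rw [Matrix.inv_def, Ring.inverse_eq_inv', hdinv]
  exact forall_mem_smul O (forall_mem_adjugate O hA) hdO

end Entrywise


/-! ## §4 The shifted order: `φ(1 + cW) = N₊N₋⁻¹`, `N± = 2 + (c±1)W`, and `φ(M), φ(M)⁻¹ ∈ 𝒪[W]`, `W ∈ 𝒪[φ(M)]` -/

section Order

variable {K : Type*} [Field K] {n : Type*} [Fintype n] [DecidableEq n] (O : Subring K)

/-- **The Möbius shift of `M = 1 + c·W` in terms of `W`**: `(c+1)M + (c−1) = c·N₊`, `(c−1)M + (c+1) = c·N₋` with `N± = 2 + (c±1)W`, hence `φ(M) = N₊·N₋⁻¹` (`c ≠ 0`, `det N₋` a unit).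
[cite: Kottwitz1986, §3] [cite: Weyl1939, Chap. II §10] -/
theorem moebius_one_add_smul_eq (W : Matrix n n K) {c : K} (hc0 : c ≠ 0) (hN : IsUnit ((2 : K) • (1 : Matrix n n K) + (c - 1) • W).det) :
    ((c + 1) • ((1 : Matrix n n K) + c • W) + (c - 1) • (1 : Matrix n n K)) * ((c - 1) • ((1 : Matrix n n K) + c • W) + (c + 1) • (1 : Matrix n n K))⁻¹ =
      ((2 : K) • (1 : Matrix n n K) + (c + 1) • W) * ((2 : K) • (1 : Matrix n n K) + (c - 1) • W)⁻¹ := by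
  have hp : (c + 1) • ((1 : Matrix n n K) + c • W) + (c - 1) • (1 : Matrix n n K) = c • ((2 : K) • (1 : Matrix n n K) + (c + 1) • W) := by
    rw [smul_add, smul_add, smul_smul, smul_smul, smul_smul]; module
  have hm : (c - 1) • ((1 : Matrix n n K) + c • W) + (c + 1) • (1 : Matrix n n K) = c • ((2 : K) • (1 : Matrix n n K) + (c - 1) • W) := by
    rw [smul_add, smul_add, smul_smul, smul_smul, smul_smul]; module
  have hinv : (c • ((2 : K) • (1 : Matrix n n K) + (c - 1) • W))⁻¹ = c⁻¹ • ((2 : K) • (1 : Matrix n n K) + (c - 1) • W)⁻¹ :=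
    Matrix.inv_eq_right_inv (by rw [smul_mul_assoc, mul_smul_comm, smul_smul, Matrix.mul_nonsing_inv _ hN, mul_inv_cancel₀ hc0, one_smul])
  rw [hp, hm, hinv, smul_mul_assoc, mul_smul_comm, smul_smul, mul_inv_cancel₀ hc0, one_smul]

/-- `N = x·1 + y·W` lies in the order `𝒪[W]` for `x, y ∈ O`. [cite: Kottwitz1986, §3] -/
theorem smul_one_add_smul_mem_adjoin (W : Matrix n n K) {x y : K} (hx : x ∈ O) (hy : y ∈ O) :
    x • (1 : Matrix n n K) + y • W ∈ Algebra.adjoin O ({W} : Set (Matrix n n K)) :=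
  Subalgebra.add_mem _ (smul_mem_adjoin_of_mem O (Subalgebra.one_mem _) hx) (smul_mem_adjoin_of_mem O (Algebra.self_mem_adjoin_singleton O W) hy)

omit [Fintype n] in
/-- `N = x·1 + y·W` is entrywise integral for `W` entrywise integral and `x, y ∈ O`. [cite: HornJohnson2013, §0.8.2] -/
theorem forall_mem_smul_one_add_smul {W : Matrix n n K} (hW : ∀ i j, W i j ∈ O) {x y : K} (hx : x ∈ O) (hy : y ∈ O) :
    ∀ i j, (x • (1 : Matrix n n K) + y • W) i j ∈ O :=
  forall_mem_add O (forall_mem_smul_one O hx) (forall_mem_smul O hW hy)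

/-- **`φ(M) = N₊N₋⁻¹ ∈ 𝒪[W]`** when `W` is entrywise integral, `c ∈ O` and `det N₋` is a unit of `O`. [cite: Kottwitz1986, §3] [cite: HornJohnson2013, §2.1] -/
theorem moebius_mem_adjoin {W : Matrix n n K} (hW : ∀ i j, W i j ∈ O) {c : K} (hc : c ∈ O)
    (hm : ∃ d ∈ O, d * ((2 : K) • (1 : Matrix n n K) + (c - 1) • W).det = 1) :
    ((2 : K) • (1 : Matrix n n K) + (c + 1) • W) * ((2 : K) • (1 : Matrix n n K) + (c - 1) • W)⁻¹ ∈ Algebra.adjoin O ({W} : Set (Matrix n n K)) := by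
  have h2 : (2 : K) ∈ O := by simp
  refine Subalgebra.mul_mem _ (smul_one_add_smul_mem_adjoin O W h2 (O.add_mem hc O.one_mem)) ?_
  exact inv_mem_adjoin_of_charpoly_coeff_mem O (smul_one_add_smul_mem_adjoin O W h2 (O.sub_mem hc O.one_mem))
    (charpoly_coeff_mem_of_forall_mem O (forall_mem_smul_one_add_smul O hW h2 (O.sub_mem hc O.one_mem))) hm

/-- **`φ(M)⁻¹ = N₋N₊⁻¹ ∈ 𝒪[W]`** when moreover `det N₊` is a unit of `O`. [cite: Kottwitz1986, §3] [cite: HornJohnson2013, §2.1] -/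
theorem moebius_inv_mem_adjoin {W : Matrix n n K} (hW : ∀ i j, W i j ∈ O) {c : K} (hc : c ∈ O)
    (hm : ∃ d ∈ O, d * ((2 : K) • (1 : Matrix n n K) + (c - 1) • W).det = 1) (hp : ∃ d ∈ O, d * ((2 : K) • (1 : Matrix n n K) + (c + 1) • W).det = 1) :
    (((2 : K) • (1 : Matrix n n K) + (c + 1) • W) * ((2 : K) • (1 : Matrix n n K) + (c - 1) • W)⁻¹)⁻¹ ∈ Algebra.adjoin O ({W} : Set (Matrix n n K)) := by
  have h2 : (2 : K) ∈ O := by simp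
  have hmu : IsUnit ((2 : K) • (1 : Matrix n n K) + (c - 1) • W).det := by
    obtain ⟨d, -, hd⟩ := hm; exact IsUnit.of_mul_eq_one_right d hd
  rw [Matrix.mul_inv_rev, Matrix.nonsing_inv_nonsing_inv _ hmu]
  refine Subalgebra.mul_mem _ (smul_one_add_smul_mem_adjoin O W h2 (O.sub_mem hc O.one_mem)) ?_
  exact inv_mem_adjoin_of_charpoly_coeff_mem O (smul_one_add_smul_mem_adjoin O W h2 (O.add_mem hc O.one_mem))
    (charpoly_coeff_mem_of_forall_mem O (forall_mem_smul_one_add_smul O hW h2 (O.add_mem hc O.one_mem))) hp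

/-- The key identity of the inverse shift: `((c+1) − (c−1)φ(M))·N₋ = 4`. [cite: Weyl1939, Chap. II §10] -/
theorem sub_smul_moebius_mul_eq (W : Matrix n n K) (c : K) (hN : IsUnit ((2 : K) • (1 : Matrix n n K) + (c - 1) • W).det) :
    ((c + 1) • (1 : Matrix n n K) - (c - 1) • (((2 : K) • (1 : Matrix n n K) + (c + 1) • W) * ((2 : K) • (1 : Matrix n n K) + (c - 1) • W)⁻¹)) *
        ((2 : K) • (1 : Matrix n n K) + (c - 1) • W) = (4 : K) • (1 : Matrix n n K) := by
  rw [sub_mul, smul_mul_assoc, smul_mul_assoc, Matrix.one_mul, Matrix.mul_assoc, Matrix.nonsing_inv_mul _ hN, Matrix.mul_one,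
    smul_add, smul_add, smul_smul, smul_smul, smul_smul, smul_smul]
  module

/-- **`W ∈ 𝒪[φ(M)]`** (the converse inclusion of the order identity `𝒪[W] = 𝒪[φ(M)]`): with `Y = N₊N₋⁻¹` and `D = (c+1) − (c−1)Y` one has `D·N₋ = 4`, so `N₋ = 4·D⁻¹ ∈ 𝒪[Y]` by
Cayley–Hamilton (`D` is entrywise integral with `det D·det N₋ = 4ⁿ` a unit) and `W = (c−1)⁻¹(N₋ − 2)`; needs `2`, `c − 1`, `det N₋` units of `O` (NOT `det N₊`).
[cite: Kottwitz1986, §3] [cite: HornJohnson2013, §2.1] -/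
theorem mem_adjoin_moebius {W : Matrix n n K} (hW : ∀ i j, W i j ∈ O) {c : K} (hc : c ∈ O) (h2 : ∃ e ∈ O, e * 2 = 1) (hc1 : ∃ e ∈ O, e * (c - 1) = 1)
    (hm : ∃ d ∈ O, d * ((2 : K) • (1 : Matrix n n K) + (c - 1) • W).det = 1) :
    W ∈ Algebra.adjoin O ({((2 : K) • (1 : Matrix n n K) + (c + 1) • W) * ((2 : K) • (1 : Matrix n n K) + (c - 1) • W)⁻¹} : Set (Matrix n n K)) := by
  have h2O : (2 : K) ∈ O := by simp
  set Np : Matrix n n K := (2 : K) • (1 : Matrix n n K) + (c + 1) • W with hNp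
  set Nm : Matrix n n K := (2 : K) • (1 : Matrix n n K) + (c - 1) • W with hNm
  set Y : Matrix n n K := Np * Nm⁻¹ with hY
  set D : Matrix n n K := (c + 1) • (1 : Matrix n n K) - (c - 1) • Y with hDdef
  obtain ⟨dm, hdmO, hdm⟩ := hm
  obtain ⟨e, heO, he⟩ := h2
  obtain ⟨e1, he1O, he1⟩ := hc1
  have hmu : IsUnit Nm.det := IsUnit.of_mul_eq_one_right dm hdm
  have hkey : D * Nm = (4 : K) • (1 : Matrix n n K) := sub_smul_moebius_mul_eq W c hmu
  -- `D` is entrywise integral, lies in `𝒪[Y]`, and `det D · det N₋ = 4ⁿ`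
  have hYint : ∀ i j, Y i j ∈ O :=
    forall_mem_mul O (forall_mem_smul_one_add_smul O hW h2O (O.add_mem hc O.one_mem)) (forall_mem_inv O (forall_mem_smul_one_add_smul O hW h2O (O.sub_mem hc O.one_mem)) ⟨dm, hdmO, hdm⟩)
  have hDint : ∀ i j, D i j ∈ O := by
    rw [hDdef, sub_eq_add_neg, ← neg_smul]
    exact forall_mem_smul_one_add_smul O hYint (O.add_mem hc O.one_mem) (O.neg_mem (O.sub_mem hc O.one_mem))
  have hDmem : D ∈ Algebra.adjoin O ({Y} : Set (Matrix n n K)) := by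
    rw [hDdef, sub_eq_add_neg, ← neg_smul]
    exact smul_one_add_smul_mem_adjoin O Y (O.add_mem hc O.one_mem) (O.neg_mem (O.sub_mem hc O.one_mem))
  have hdet : D.det * Nm.det = (4 : K) ^ Fintype.card n := by
    rw [← Matrix.det_mul, hkey, Matrix.det_smul, Matrix.det_one, mul_one]
  have hDunit : ∃ d ∈ O, d * D.det = 1 := by
    refine ⟨Nm.det * (e ^ 2) ^ Fintype.card n, O.mul_mem (det_mem_of_forall_mem O (forall_mem_smul_one_add_smul O hW h2O (O.sub_mem hc O.one_mem))) (O.pow_mem (O.pow_mem heO 2) _), ?_⟩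
    calc Nm.det * (e ^ 2) ^ Fintype.card n * D.det = (D.det * Nm.det) * (e ^ 2) ^ Fintype.card n := by ring
      _ = 1 := by rw [hdet, ← mul_pow, show (4 : K) * e ^ 2 = (e * 2) ^ 2 by ring, he, one_pow, one_pow]
  have hDinv : D⁻¹ ∈ Algebra.adjoin O ({Y} : Set (Matrix n n K)) :=
    inv_mem_adjoin_of_charpoly_coeff_mem O hDmem (charpoly_coeff_mem_of_forall_mem O hDint) hDunit
  -- `N₋ = 4 · D⁻¹` and `W = (c−1)⁻¹ (N₋ − 2)`
  have hDu : IsUnit D.det := by obtain ⟨d, -, hd⟩ := hDunit; exact IsUnit.of_mul_eq_one_right d hd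
  have hNm_eq : Nm = (4 : K) • D⁻¹ := by
    calc Nm = D⁻¹ * (D * Nm) := by rw [← Matrix.mul_assoc, Matrix.nonsing_inv_mul _ hDu, Matrix.one_mul]
      _ = (4 : K) • D⁻¹ := by rw [hkey, mul_smul_comm, Matrix.mul_one]
  have hNm_mem : Nm ∈ Algebra.adjoin O ({Y} : Set (Matrix n n K)) := by
    rw [hNm_eq]; exact smul_mem_adjoin_of_mem O hDinv (by simp)
  have hW_eq : W = e1 • (Nm - (2 : K) • (1 : Matrix n n K)) := by
    rw [hNm, add_sub_cancel_left, smul_smul, he1, one_smul]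
  rw [hW_eq]
  exact smul_mem_adjoin_of_mem O (Subalgebra.sub_mem _ hNm_mem (smul_mem_adjoin_of_mem O (Subalgebra.one_mem _) h2O)) he1O

end Order

/-! ## §5 The invariants of the shift of a `2 × 2` matrix, eigenvalue-free -/

section FinTwo

variable {K : Type*} [Field K]

/-- `det(x·g + y) = x²·det g + xy·tr g + y²` for a `2 × 2` matrix. [cite: HornJohnson2013, §0.8.2] -/
theorem det_smul_add_smul_one_fin_two (g : Matrix (Fin 2) (Fin 2) K) (x y : K) :
    (x • g + y • (1 : Matrix (Fin 2) (Fin 2) K)).det = x ^ 2 * g.det + x * y * g.trace + y ^ 2 := by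
  rw [Matrix.det_fin_two, Matrix.det_fin_two, Matrix.trace_fin_two]
  simp
  ring

/-- `det φ(M) = det N ∕ det D` (any size, over a field). [cite: HornJohnson2013, §0.8.2] -/
theorem det_mul_inv_eq_div {n : Type*} [Fintype n] [DecidableEq n] (N D : Matrix n n K) : (N * D⁻¹).det = N.det / D.det := by
  rw [Matrix.det_mul, Matrix.det_nonsing_inv, Ring.inverse_eq_inv', div_eq_mul_inv]

/-- `tr(N·D⁻¹)·det D = tr N·tr D − tr(N·D)` for `2 × 2` matrices with `det D ≠ 0`. [cite: HornJohnson2013, §0.8.2] -/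
theorem trace_mul_inv_mul_det_fin_two (N D : Matrix (Fin 2) (Fin 2) K) (hD : D.det ≠ 0) :
    (N * D⁻¹).trace * D.det = N.trace * D.trace - (N * D).trace := by
  rw [Matrix.inv_def, Ring.inverse_eq_inv', Matrix.adjugate_fin_two]
  rw [Matrix.det_fin_two] at hD
  simp [Matrix.trace_fin_two, Matrix.det_fin_two, Matrix.mul_apply, Fin.sum_univ_two] at hD ⊢
  field_simp
  ring

/-- **The discriminant of the shift**: `disc χ_{φ(g)}·(det D)² = (a² − b²)²·disc χ_g` for `g` `2 × 2`, `D = b·g + a`, `N = a·g + b`, `det D ≠ 0` — the root distance of `φ(g)` is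
that of `g` times `(a²−b²)∕det D`, without naming a root. [cite: HornJohnson2013, §2.1] [cite: Kottwitz1986, §3] -/
theorem disc_moebius_fin_two (g : Matrix (Fin 2) (Fin 2) K) (a b : K) (hD : (b • g + a • (1 : Matrix (Fin 2) (Fin 2) K)).det ≠ 0) :
    (((a • g + b • (1 : Matrix (Fin 2) (Fin 2) K)) * (b • g + a • (1 : Matrix (Fin 2) (Fin 2) K))⁻¹).trace ^ 2 -
        4 * ((a • g + b • (1 : Matrix (Fin 2) (Fin 2) K)) * (b • g + a • (1 : Matrix (Fin 2) (Fin 2) K))⁻¹).det) *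
      (b • g + a • (1 : Matrix (Fin 2) (Fin 2) K)).det ^ 2 = (a ^ 2 - b ^ 2) ^ 2 * (g.trace ^ 2 - 4 * g.det) := by
  set N : Matrix (Fin 2) (Fin 2) K := a • g + b • 1 with hN
  set D : Matrix (Fin 2) (Fin 2) K := b • g + a • 1 with hDdef
  have htr := trace_mul_inv_mul_det_fin_two N D hD
  have hdet : (N * D⁻¹).det * D.det = N.det := by rw [det_mul_inv_eq_div, div_mul_cancel₀ _ hD]
  calc ((N * D⁻¹).trace ^ 2 - 4 * (N * D⁻¹).det) * D.det ^ 2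
      = ((N * D⁻¹).trace * D.det) ^ 2 - 4 * ((N * D⁻¹).det * D.det) * D.det := by ring
    _ = (N.trace * D.trace - (N * D).trace) ^ 2 - 4 * N.det * D.det := by rw [htr, hdet]
    _ = (a ^ 2 - b ^ 2) ^ 2 * (g.trace ^ 2 - 4 * g.det) := by
        simp [hN, hDdef, Matrix.trace_fin_two, Matrix.det_fin_two, Matrix.mul_apply, Fin.sum_univ_two, Matrix.one_apply]
        ring

/-- **The value of the shift at the shifted point**: `χ_{φ(g)}(φ(u))·(bu + a)²·det D = (a² − b²)²·χ_g(u)` (`2 × 2`, `det D ≠ 0`, `bu + a ≠ 0`).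
[cite: HornJohnson2013, §2.1] [cite: Kottwitz1986, §3] -/
theorem eval_charpoly_moebius_fin_two (g : Matrix (Fin 2) (Fin 2) K) (a b u : K) (hD : (b • g + a • (1 : Matrix (Fin 2) (Fin 2) K)).det ≠ 0) (hu : b * u + a ≠ 0) :
    ((a • g + b • (1 : Matrix (Fin 2) (Fin 2) K)) * (b • g + a • (1 : Matrix (Fin 2) (Fin 2) K))⁻¹).charpoly.eval ((a * u + b) / (b * u + a)) * (b * u + a) ^ 2 *
      (b • g + a • (1 : Matrix (Fin 2) (Fin 2) K)).det = (a ^ 2 - b ^ 2) ^ 2 * g.charpoly.eval u := by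
  set N : Matrix (Fin 2) (Fin 2) K := a • g + b • 1 with hN
  set D : Matrix (Fin 2) (Fin 2) K := b • g + a • 1 with hDdef
  have htr := trace_mul_inv_mul_det_fin_two N D hD
  have hdet : (N * D⁻¹).det * D.det = N.det := by rw [det_mul_inv_eq_div, div_mul_cancel₀ _ hD]
  rw [Matrix.charpoly_fin_two, Matrix.charpoly_fin_two]
  simp only [eval_add, eval_sub, eval_mul, eval_pow, eval_C, eval_X]
  have e1 : ((a * u + b) / (b * u + a)) ^ 2 * (b * u + a) ^ 2 = (a * u + b) ^ 2 := by
    rw [div_pow, div_mul_cancel₀ _ (pow_ne_zero 2 hu)]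
  have e2 : (a * u + b) / (b * u + a) * (b * u + a) ^ 2 = (a * u + b) * (b * u + a) := by
    rw [pow_two, ← mul_assoc, div_mul_cancel₀ _ hu]
  calc (((a * u + b) / (b * u + a)) ^ 2 - (N * D⁻¹).trace * ((a * u + b) / (b * u + a)) + (N * D⁻¹).det) * (b * u + a) ^ 2 * D.det
      = ((a * u + b) / (b * u + a)) ^ 2 * (b * u + a) ^ 2 * D.det - ((N * D⁻¹).trace * D.det) * ((a * u + b) / (b * u + a) * (b * u + a) ^ 2) +
          ((N * D⁻¹).det * D.det) * (b * u + a) ^ 2 := by ring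
    _ = (a * u + b) ^ 2 * D.det - (N.trace * D.trace - (N * D).trace) * ((a * u + b) * (b * u + a)) + N.det * (b * u + a) ^ 2 := by rw [e1, e2, htr, hdet]
    _ = (a ^ 2 - b ^ 2) ^ 2 * (u ^ 2 - g.trace * u + g.det) := by
        simp [hN, hDdef, Matrix.trace_fin_two, Matrix.det_fin_two, Matrix.mul_apply, Fin.sum_univ_two, Matrix.one_apply]
        ring

end FinTwo

end Literature.NumberTheory.Automorphic.MoebiusShift
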